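import Literature.Probability.Percolation.QuadCrossingSpaceProofs
import Literature.Probability.Percolation.QuadCrossingNoiseProofs
import Mathlib.Topology.Order.Monotone
import Mathlib.Topology.Algebra.Module.Cardinality
import HarnessLib

/-!
# Crossing events of a dense set of quads are continuity sets; Theorem 1.7 from Proposition 4.1

Topic `Literature/Probability/Percolation`; second proofs file (after `QuadCrossingNoiseProofs.lean`)
for the named fact `SchrammSmirnov2011_thm_1_7` of `QuadCrossingNoise.lean` (O. Schramm,
S. Smirnov, *On the scaling limits of planar percolation*, Ann. Probab. 39 (2011) 1768–1814,
arXiv:1101.5820, Thm. 1.7 "Factorization").  Proofs only: no named fact is introduced (D-0026).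

**The printed proof of Theorem 1.7** (p. 21 of the arXiv version): "Take a smooth quad `Q₀ ∈ 𝒬_D`.
By Proposition 4.1 [mesh-independent gluing: for every `ε > 0` a finite set of piecewise smooth
quads `𝒬_ε ⊂ 𝒬_{D∖α}` and `𝓦_ε` measurable w.r.t. `σ(⊞_Q, Q ∈ 𝒬_ε)` with
`limsup_{|η|→0} μ_η(𝓦_ε ∆ ⊞_{Q₀}) < ε`] and Corollary 5.2 [`μ(𝓜) = lim μ_η(𝓜)` for `𝓜` in the
Boolean algebra of finitely many `⊞_Q`, from Lemma 5.1: `μ(∂⊞_{Q₀}) = 0` for every `Q₀`, and the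
portmanteau theorem], we have `⊞_{Q₀} ∈ 𝓕_{D∖α}` (5.2).  Since such collection of quads is dense in
`𝒬_D`, Theorem 1.7 follows from Theorem 1.4 (2)."  And the proof of Lemma 5.1 (ibid.): with `Q̂₀`
an extension of `Q₀` and the perturbations `Q^q`, `Q' := Q^{q_{-δ₀/2}} < Q₀ < Q'' := Q^{q_{δ₀/2}}`,
"`⊞_{Q₀} ⊇ V_{U'} ⊇ ⊞_{Q''}` … hence the closure of `V^{Q₀}` is contained in `V^{Q''}` …
`∂⊞_{Q₀} ⊂ ⊞_{Q₀} ⊂ V_U` … the open set `V_U ∩ V^{Q''}` contains `∂⊞_{Q₀}`.  The portmanteau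
theorem therefore gives `μ(∂⊞_{Q₀}) ≤ … ≤ limsup μ_η(⊞_{Q'} ∆ ⊞_{Q''})`", the right-hand side
being small by the Russo–Seymour–Welsh continuity Lemma 6.1.

**What this file proves.**

* `Quad.rectMap`, `Quad.rectQuad`, `Quad.scaleXY`, `Quad.shrinkFamily` — the rectangles
  `[-a, a] × [-b, b]` read through a homeomorphism `H` of the plane extending the quad
  (`Quad.exists_homeomorph_extend`, `QuadCrossingSpaceProofs.lean`), i.e. Schramm–Smirnov's
  perturbations `Q^q`, and the one-parameter family `s ↦ Q_s = H ∘ rectMap (1-s) (1+s)`;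
* `Quad.dominated_of_near_rect`, `Quad.strictlyDominated_rectQuad`,
  `Quad.strictlyDominated_shrinkFamily` — "then `Q' < Q₀ < Q''`": a strictly narrower and strictly
  taller rectangle read through `H` is a strictly smaller quad (the crossing lemma
  `exists_subcontinuum_crossing` of `BandCrossing.lean` after a coordinate scaling), so the family
  is strictly decreasing and the crossing events `⊞_{Q_s}` increase with `s`;
* `QuadConfig.frontier_crossedEvent_subset_sdiff`, `QuadConfig.measure_frontier_crossedEvent_le` —
  the topological half of the proof of Lemma 5.1: `Q' < Q₀ < Q_m < Q''` implies
  `∂⊞_{Q₀} ⊆ ⊞_{Q'} ∖ ⊞_{Q''}`, hence `μ(∂⊞_{Q₀}) ≤ μ(⊞_{Q'}) - μ(⊞_{Q''})`;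
* `Quad.exists_strictlyDominated_measure_frontier_eq_zero`,
  `Quad.dense_setOf_measure_frontier_crossedEvent_eq_zero` — **for EVERY finite Borel measure `μ`
  on `ℋ_D` (`D` open) the quads `Q` with `μ(∂⊞_Q) = 0` are dense in `𝒬_D`** (indeed below every
  quad): `s ↦ μ(⊞_{Q_s})` is monotone, hence continuous off a countable set of parameters, and at
  a continuity point the sandwich above forces `μ(∂⊞_{Q_{s₀}}) = 0`.  This soft statement is all
  that the proof of Theorem 1.7 uses of Lemma 5.1 AT THE QUAD `Q₀` (which ranges over a dense set
  anyway); the Russo–Seymour–Welsh estimate of Lemma 6.1 is what upgrades it, in print, to every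
  quad (no jump of `s ↦ μ(⊞_{Q_s})` at the given parameter) — that upgrade is the named fact
  `SchrammSmirnov2011_lemma_5_1` (`QuadCrossingContinuityEvents.lean`) and is not proved here;
* `tendsto_measure_of_null_frontier_generateFrom` (Cor. 5.2 for finitely many continuity quads),
  `exists_measurableSet_crossingField_ae_eq_of_gluing_of_null_frontier` ((5.2) at a continuity quad)
  and the assemblies `SchrammSmirnov2011_thm_1_7_of_gluing` (Theorem 1.7 from the conclusion of
  Prop. 4.1 at the `μ`-continuity quads, with the quads `𝒬_ε` taken among the `μ`-continuity
  quads — NO named fact as hypothesis; Thm. 1.4 enters through `SchrammSmirnov2011_thm_1_4_holds`)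
  and `SchrammSmirnov2011_thm_1_7_of_lemma_5_1_of_gluing` (from Lemma 5.1 and Prop. 4.1 verbatim).

What then remains of `SchrammSmirnov2011_thm_1_7_holds` is Proposition 4.1 of the source for the
bond-`ℤ²` laws `squareCrossingLaw` ("the most technically difficult part of our paper", §4: bays,
beaches and coarse-graining, on top of the discrete gluing Theorem 1.1 of §2, the pivotal estimate
(1.2) — Garban's appendix, the tree's unproved `Garban2011_fourArm_multiscale` — and the RSW
Lemmas 6.1–6.2); it is a theorem to be proved, deliberately not stated here as a fact.

## References

* O. Schramm, S. Smirnov, Ann. Probab. 39 (2011) 1768–1814, arXiv:1101.5820: §1.3, Thm. 1.4,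
  Thm. 1.7 and its proof (§5, p. 21), Prop. 4.1, Lemma 5.1 (proof), Cor. 5.2, Lemma 6.1.
  [SchrammSmirnov2011]
-/

noncomputable section

open scoped unitInterval Topology ENNReal NNReal symmDiff
open Set Filter Metric Function Complex MeasureTheory
open Literature.Topology.PlaneTopology

namespace Literature.Probability.Percolation

namespace QuadCrossing

variable {D : Set ℂ}

namespace Quad

/-! ### Rectangles read through a homeomorphism of the plane -/

/-- The affine chart of `[0,1]²` onto the rectangle `[-a, a] × [-b, b]`:
`(x, y) ↦ a(2x - 1) + i b(2y - 1)`.  For `a = b = 1` this is the chart of `[-1, 1]²` of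
`QuadCrossingSpaceProofs`, for `(a, b) = (1 - s, 1 + s)` its taller-and-narrower rectangle
(Schramm–Smirnov's `Q^q`, `q = (s, -s, 1 - s, 1 + s)`). [cite: SchrammSmirnov2011, proof of Lemma 5.1] -/
def rectMap (a b : ℝ) (p : I × I) : ℂ :=
  (((a * (2 * (p.1 : ℝ) - 1)) : ℝ) : ℂ) + (((b * (2 * (p.2 : ℝ) - 1)) : ℝ) : ℂ) * Complex.I

/-- Real and imaginary parts of `rectMap a b p`. [folklore] -/
theorem rectMap_re_im (a b : ℝ) (p : I × I) :
    (rectMap a b p).re = a * (2 * (p.1 : ℝ) - 1) ∧ (rectMap a b p).im = b * (2 * (p.2 : ℝ) - 1) :=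
  re_im_ofReal_add_ofReal_mul_I _ _

/-- `rectMap 1 1` is the chart `(x, y) ↦ (2x - 1) + (2y - 1)i` of the square. [folklore] -/
theorem rectMap_one_one (p : I × I) :
    rectMap 1 1 p = (((2 * (p.1 : ℝ) - 1 : ℝ) : ℂ) + ((2 * (p.2 : ℝ) - 1 : ℝ) : ℂ) * Complex.I) := by
  simp [rectMap]

/-- The coordinates `2x - 1`, `2y - 1` of a point of the square lie in `[-1, 1]`. [folklore] -/
theorem abs_two_mul_sub_one_le (t : I) : |2 * (t : ℝ) - 1| ≤ 1 := by
  have h := t.2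
  simp only [mem_Icc] at h
  exact abs_le.2 ⟨by linarith [h.1], by linarith [h.2]⟩

/-- `rectMap` is continuous in the point. [folklore] -/
theorem continuous_rectMap (a b : ℝ) : Continuous (rectMap a b) := by
  unfold rectMap; fun_prop

/-- `rectMap a b` is injective for `a, b ≠ 0`. [folklore] -/
theorem rectMap_injective {a b : ℝ} (ha : a ≠ 0) (hb : b ≠ 0) : Injective (rectMap a b) := by
  intro p q hpq
  have h := ofReal_add_ofReal_mul_I_inj hpq
  have h1 : (p.1 : ℝ) = q.1 := by
    have := mul_left_cancel₀ ha h.1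
    linarith
  have h2 : (p.2 : ℝ) = q.2 := by
    have := mul_left_cancel₀ hb h.2
    linarith
  exact Prod.ext (Subtype.ext h1) (Subtype.ext h2)

/-- Two rectangle charts differ pointwise by at most `|a - a'| + |b - b'|`. [folklore] -/
theorem norm_rectMap_sub_rectMap_le (a b a' b' : ℝ) (p : I × I) :
    ‖rectMap a b p - rectMap a' b' p‖ ≤ |a - a'| + |b - b'| := by
  have : rectMap a b p - rectMap a' b' p =
      ((((a - a') * (2 * (p.1 : ℝ) - 1)) : ℝ) : ℂ) +
        ((((b - b') * (2 * (p.2 : ℝ) - 1)) : ℝ) : ℂ) * Complex.I := by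
    simp only [rectMap]; push_cast; ring
  rw [this]
  calc ‖((((a - a') * (2 * (p.1 : ℝ) - 1)) : ℝ) : ℂ) +
        ((((b - b') * (2 * (p.2 : ℝ) - 1)) : ℝ) : ℂ) * Complex.I‖
      ≤ ‖((((a - a') * (2 * (p.1 : ℝ) - 1)) : ℝ) : ℂ)‖ +
          ‖((((b - b') * (2 * (p.2 : ℝ) - 1)) : ℝ) : ℂ) * Complex.I‖ := norm_add_le _ _
    _ = |a - a'| * |2 * (p.1 : ℝ) - 1| + |b - b'| * |2 * (p.2 : ℝ) - 1| := by
        rw [norm_mul, norm_I, mul_one, norm_real, norm_real, Real.norm_eq_abs,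
          Real.norm_eq_abs, abs_mul, abs_mul]
    _ ≤ |a - a'| * 1 + |b - b'| * 1 := by
        gcongr
        · exact abs_two_mul_sub_one_le p.1
        · exact abs_two_mul_sub_one_le p.2
    _ = |a - a'| + |b - b'| := by ring

/-- **The quad `H ∘ rectMap a b`**: the rectangle `[-a, a] × [-b, b]` (`a, b > 0`) read through a
homeomorphism `H` of the plane, when its image lies in `D` — Schramm–Smirnov's perturbations
`Q^q` of a quad `Q₀ = H ∘ rectMap 1 1` (proof of Lemma 5.1). [cite: SchrammSmirnov2011, proof of Lemma 5.1] -/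
def rectQuad (H : ℂ ≃ₜ ℂ) (a b : ℝ) (ha : 0 < a) (hb : 0 < b)
    (hD : ∀ p : I × I, H (rectMap a b p) ∈ D) : Quad D where
  toFun p := H (rectMap a b p)
  continuous_toFun := H.continuous.comp (continuous_rectMap a b)
  injective_toFun := H.injective.comp (rectMap_injective ha.ne' hb.ne')
  range_subset := by
    rintro _ ⟨p, rfl⟩
    exact hD p

/-- `rectQuad_apply`: structural lemma. [folklore] -/
@[simp] theorem rectQuad_apply (H : ℂ ≃ₜ ℂ) (a b : ℝ) (ha : 0 < a) (hb : 0 < b)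
    (hD : ∀ p : I × I, H (rectMap a b p) ∈ D) (p : I × I) :
    rectQuad H a b ha hb hD p = H (rectMap a b p) := rfl

/-! ### Coordinate scalings of the plane -/

/-- The coordinate scaling `x + iy ↦ a x + i b y` (`a, b ≠ 0`), a homeomorphism of `ℂ`.
[folklore] -/
def scaleXY (a b : ℝ) (ha : a ≠ 0) (hb : b ≠ 0) : ℂ ≃ₜ ℂ where
  toFun z := ((a * z.re : ℝ) : ℂ) + ((b * z.im : ℝ) : ℂ) * Complex.I
  invFun z := ((z.re / a : ℝ) : ℂ) + ((z.im / b : ℝ) : ℂ) * Complex.I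
  left_inv z := by
    apply Complex.ext
    · simp only [(re_im_ofReal_add_ofReal_mul_I _ _).1, (re_im_ofReal_add_ofReal_mul_I _ _).2]
      field_simp
    · simp only [(re_im_ofReal_add_ofReal_mul_I _ _).1, (re_im_ofReal_add_ofReal_mul_I _ _).2]
      field_simp
  right_inv z := by
    apply Complex.ext
    · simp only [(re_im_ofReal_add_ofReal_mul_I _ _).1, (re_im_ofReal_add_ofReal_mul_I _ _).2]
      field_simp
    · simp only [(re_im_ofReal_add_ofReal_mul_I _ _).1, (re_im_ofReal_add_ofReal_mul_I _ _).2]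
      field_simp
  continuous_toFun := by fun_prop
  continuous_invFun := by fun_prop

/-- A coordinate scaling maps rectangle charts to rectangle charts. [folklore] -/
theorem scaleXY_rectMap (a b : ℝ) (ha : a ≠ 0) (hb : b ≠ 0) (c d : ℝ) (p : I × I) :
    scaleXY a b ha hb (rectMap c d p) = rectMap (a * c) (b * d) p := by
  show ((a * (rectMap c d p).re : ℝ) : ℂ) + ((b * (rectMap c d p).im : ℝ) : ℂ) * Complex.I = _
  rw [(rectMap_re_im c d p).1, (rectMap_re_im c d p).2, rectMap]
  push_cast; ring

end Quad


namespace Quad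

/-! ### Domination from closeness in the straightened picture (general reference rectangle) -/

/-- **`P ≤ P'` from the crossing lemma, with a wider-and-shorter reference rectangle for `P'`.**
Let `H : ℂ ≃ₜ ℂ`, `s ≤ 1/2`, `0 < η`, `4η < s`, `A ≥ 1 ≥ B > 0`.  If `H⁻¹ ∘ P'` is uniformly
`η`-close to the chart `rectMap A B` of `[-A, A] × [-B, B]` and `H⁻¹ ∘ P` is uniformly `η`-close to
the chart `rectMap (1-s) (1+s)` of the taller-and-narrower rectangle `[-(1-s), 1-s] × [-(1+s), 1+s]`,
then every crossing of `P'` contains a crossing of `P`.  This is `Quad.dominated_of_near`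
(the case `A = B = 1`) verbatim, the reference square of `P'` being replaced by any rectangle at
least as wide and at most as tall: pull a crossing of `P'` back by `H⁻¹` — it lies in
`{|Im| ≤ B + η} ⊆ {|Im| ≤ 1 + η}` and reaches `{Re ≤ -A + η} ⊆ {Re ≤ -1 + η}` and `{Re ≥ 1 - η}` —,
apply `exists_subcontinuum_crossing` (`BandCrossing.lean`) and push forward by `H`.
[cite: SchrammSmirnov2011, §3 (3.2) and proof of Lemma 5.1] -/
theorem dominated_of_near_rect (H : ℂ ≃ₜ ℂ) {s η A B : ℝ} (hs' : s ≤ 1 / 2) (hη : 0 < η)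
    (hηs : 4 * η < s) (hA : 1 ≤ A) (hB₀ : 0 < B) (hB : B ≤ 1) {P P' : Quad D}
    (hP' : ∀ p : I × I, ‖H.symm (P' p) - rectMap A B p‖ ≤ η)
    (hP : ∀ p : I × I, ‖H.symm (P p) - rectMap (1 - s) (1 + s) p‖ ≤ η) :
    Dominated P P' := by
  have hs : 0 < s := by linarith
  have ha : (0 : ℝ) < 1 - s := by linarith
  have hb : (0 : ℝ) < 1 + s := by linarith
  obtain ⟨c, hcc, hce, hec⟩ := exists_chart
  set R := Icc (-(1 - s)) (1 - s) ×ℂ Icc (-(1 + s)) (1 + s) with hR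
  -- the inverse `Binv` of `A_s (x + iy) = (1-s)x + i(1+s)y`
  set Binv : ℂ → ℂ := fun w => ((w.re / (1 - s) : ℝ) : ℂ) + ((w.im / (1 + s) : ℝ) : ℂ) * Complex.I
    with hBinv
  have hBc : Continuous Binv := by fun_prop
  have hBre : ∀ w, (Binv w).re = w.re / (1 - s) ∧ (Binv w).im = w.im / (1 + s) := fun w =>
    re_im_ofReal_add_ofReal_mul_I _ _
  have hBS : ∀ w ∈ R, Binv w ∈ Icc (-1 : ℝ) 1 ×ℂ Icc (-1 : ℝ) 1 := fun w hw => by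
    rw [mem_reProdIm, mem_Icc, mem_Icc, (hBre w).1, (hBre w).2]
    rw [hR, mem_reProdIm, mem_Icc, mem_Icc] at hw
    refine ⟨⟨?_, ?_⟩, ⟨?_, ?_⟩⟩
    · rw [le_div_iff₀ ha]; linarith [hw.1.1]
    · rw [div_le_iff₀ ha]; linarith [hw.1.2]
    · rw [le_div_iff₀ hb]; linarith [hw.2.1]
    · rw [div_le_iff₀ hb]; linarith [hw.2.2]
  -- the chart coordinates of `Binv w`
  have hcB : ∀ w ∈ R, (2 * ((c (Binv w)).1 : ℝ) - 1) = w.re / (1 - s) ∧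
      (2 * ((c (Binv w)).2 : ℝ) - 1) = w.im / (1 + s) := fun w hw => by
    exact ofReal_add_ofReal_mul_I_inj (hec (Binv w) (hBS w hw))
  have hAcB : ∀ w ∈ R, rectMap (1 - s) (1 + s) (c (Binv w)) = w := fun w hw => by
    rw [rectMap, (hcB w hw).1, (hcB w hw).2, mul_div_cancel₀ _ ha.ne', mul_div_cancel₀ _ hb.ne']
    exact Complex.ext (re_im_ofReal_add_ofReal_mul_I _ _).1 (re_im_ofReal_add_ofReal_mul_I _ _).2
  -- the straightened quad `g = H⁻¹ ∘ P ∘ chart⁻¹ ∘ Binv` on `R`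
  set g : ℂ → ℂ := fun w => H.symm (P (c (Binv w))) with hg
  have hgc : Continuous g := H.symm.continuous.comp (P.continuous_toFun.comp (hcc.comp hBc))
  have hgη : ∀ w ∈ R, ‖g w - w‖ ≤ η := fun w hw => by
    have := hP (c (Binv w))
    rwa [hAcB w hw] at this
  have hgi : InjOn g R := by
    intro w hw w' hw' h
    have h1 : c (Binv w) = c (Binv w') := P.injective_toFun (H.symm.injective h)
    have h2 : Binv w = Binv w' := by rw [← hec (Binv w) (hBS w hw), ← hec (Binv w') (hBS w' hw'), h1]
    have h3 := ofReal_add_ofReal_mul_I_inj h2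
    rw [div_left_inj' ha.ne', div_left_inj' hb.ne'] at h3
    exact Complex.ext h3.1 h3.2
  -- a crossing of `P'`
  intro K hK
  obtain ⟨hKc, hKconn, hKsub, ⟨w₀, hw₀K, hw₀⟩, ⟨w₂, hw₂K, hw₂⟩⟩ := hK
  have hw₀' : w₀ ∈ P' '' {z : I × I | z.1 = 0} := hw₀
  have hw₂' : w₂ ∈ P' '' {z : I × I | z.1 = 1} := hw₂
  obtain ⟨p₀, hp₀, rfl⟩ := hw₀'
  obtain ⟨p₂, hp₂, rfl⟩ := hw₂'
  have hp₀' : ((p₀.1 : I) : ℝ) = 0 := by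
    have := congrArg Subtype.val (show p₀.1 = 0 from hp₀); simpa using this
  have hp₂' : ((p₂.1 : I) : ℝ) = 1 := by
    have := congrArg Subtype.val (show p₂.1 = 1 from hp₂); simpa using this
  have hKsub' : K ⊆ range P' := hKsub
  -- its pull-back `K̃ = H⁻¹(K)`
  have hKt_c : IsCompact (H.symm '' K) := hKc.image H.symm.continuous
  have hKt_conn : IsConnected (H.symm '' K) := hKconn.image _ H.symm.continuous.continuousOn
  have hcoord : ∀ p : I × I, |(H.symm (P' p)).re - A * (2 * (p.1 : ℝ) - 1)| ≤ η ∧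
      |(H.symm (P' p)).im - B * (2 * (p.2 : ℝ) - 1)| ≤ η := fun p => by
    have h := hP' p
    constructor
    · have := (abs_re_le_norm _).trans h
      rwa [sub_re, (rectMap_re_im A B p).1] at this
    · have := (abs_im_le_norm _).trans h
      rwa [sub_im, (rectMap_re_im A B p).2] at this
  have hKim : ∀ w ∈ H.symm '' K, |w.im| ≤ 1 + η := by
    rintro _ ⟨w, hwK, rfl⟩
    obtain ⟨p, rfl⟩ := hKsub' hwK
    have h := (hcoord p).2
    have h2 : |B * (2 * (p.2 : ℝ) - 1)| ≤ 1 := by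
      rw [abs_mul, abs_of_pos hB₀]
      calc B * |2 * (p.2 : ℝ) - 1| ≤ B * 1 :=
            mul_le_mul_of_nonneg_left (abs_two_mul_sub_one_le p.2) hB₀.le
        _ ≤ 1 := by linarith
    rw [abs_le] at h h2 ⊢
    constructor <;> linarith [h.1, h.2, h2.1, h2.2]
  have hK₀ : ∃ w ∈ H.symm '' K, w.re ≤ -1 + η := by
    refine ⟨H.symm (P' p₀), mem_image_of_mem _ hw₀K, ?_⟩
    have h := (hcoord p₀).1
    rw [hp₀', abs_le] at h
    have : A * (2 * (0 : ℝ) - 1) = -A := by ring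
    rw [this] at h
    linarith [h.2]
  have hK₂ : ∃ w ∈ H.symm '' K, 1 - η ≤ w.re := by
    refine ⟨H.symm (P' p₂), mem_image_of_mem _ hw₂K, ?_⟩
    have h := (hcoord p₂).1
    rw [hp₂', abs_le] at h
    have : A * (2 * (1 : ℝ) - 1) = A := by ring
    rw [this] at h
    linarith [h.1]
  obtain ⟨Kt', hKt'sub, hKt'c, hKt'conn, hKt'R, ⟨x₀, hx₀K, u₀, ⟨hu₀R, hu₀re⟩, rfl⟩,
    ⟨x₂, hx₂K, u₂, ⟨hu₂R, hu₂re⟩, rfl⟩⟩ :=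
    exists_subcontinuum_crossing hs' hη hηs hgc.continuousOn hgi hgη hKt_c hKt_conn hKim
      hK₀ hK₂
  -- push forward by `H`
  refine ⟨H '' Kt', ?_, hKt'c.image H.continuous, hKt'conn.image _ H.continuous.continuousOn,
    ?_, ?_, ?_⟩
  · calc H '' Kt' ⊆ H '' (H.symm '' K) := image_mono hKt'sub
      _ = K := H.toEquiv.image_symm_image K
  · rintro _ ⟨x, hx, rfl⟩
    obtain ⟨w, -, rfl⟩ := hKt'R hx
    show H (g w) ∈ range P
    exact ⟨c (Binv w), by simp [hg]⟩
  · refine ⟨H (g u₀), mem_image_of_mem H hx₀K, ?_⟩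
    show H (g u₀) ∈ P '' {z : I × I | z.1 = 0}
    refine ⟨c (Binv u₀), ?_, by simp [hg]⟩
    show (c (Binv u₀)).1 = 0
    have h := (hcB u₀ hu₀R).1
    rw [hu₀re, neg_div, div_self ha.ne'] at h
    have h' : ((c (Binv u₀)).1 : ℝ) = 0 := by linarith
    exact Subtype.ext (by simpa using h')
  · refine ⟨H (g u₂), mem_image_of_mem H hx₂K, ?_⟩
    show H (g u₂) ∈ P '' {z : I × I | z.1 = 1}
    refine ⟨c (Binv u₂), ?_, by simp [hg]⟩
    show (c (Binv u₂)).1 = 1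
    have h := (hcB u₂ hu₂R).1
    rw [hu₂re, div_self ha.ne'] at h
    have h' : ((c (Binv u₂)).1 : ℝ) = 1 := by linarith
    exact Subtype.ext (by simpa using h')

end Quad

namespace Quad

/-! ### Strict domination between rectangles read through the same homeomorphism -/

/-- Points of `rectMap a b` lie in the square `[-2, 2]²` when `|a|, |b| ≤ 2`. [folklore] -/
theorem rectMap_mem_rect_two {a b : ℝ} (ha : |a| ≤ 2) (hb : |b| ≤ 2) (p : I × I) :
    rectMap a b p ∈ Icc (-2 : ℝ) 2 ×ℂ Icc (-2 : ℝ) 2 := by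
  rw [mem_reProdIm, (rectMap_re_im a b p).1, (rectMap_re_im a b p).2, mem_Icc, mem_Icc]
  have h1 : |a * (2 * (p.1 : ℝ) - 1)| ≤ 2 := by
    rw [abs_mul]
    calc |a| * |2 * (p.1 : ℝ) - 1| ≤ 2 * 1 :=
          mul_le_mul ha (abs_two_mul_sub_one_le p.1) (abs_nonneg _) zero_le_two
      _ = 2 := by norm_num
  have h2 : |b * (2 * (p.2 : ℝ) - 1)| ≤ 2 := by
    rw [abs_mul]
    calc |b| * |2 * (p.2 : ℝ) - 1| ≤ 2 * 1 :=
          mul_le_mul hb (abs_two_mul_sub_one_le p.2) (abs_nonneg _) zero_le_two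
      _ = 2 := by norm_num
  exact ⟨abs_le.1 h1, abs_le.1 h2⟩

/-- **Strictly narrower and strictly taller rectangles are strictly smaller quads.**  For
`0 < a₁ < a₂` and `0 < b₂ < b₁`, the quad `H ∘ rectMap a₁ b₁` (narrower, taller) is `<` the quad
`H ∘ rectMap a₂ b₂` in Schramm–Smirnov's order: `Q < Q'` for all `Q` near the former and `Q'` near
the latter.  After the coordinate scaling `L = scaleXY (a₁/(1-q)) (b₁/(1+q))`,
`q = min(1/2, 1 - a₁/a₂, b₁/b₂ - 1)`, the two quads are `(H ∘ L) ∘ rectMap (1-q) (1+q)` and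
`(H ∘ L) ∘ rectMap A B` with `A = a₂(1-q)/a₁ ≥ 1`, `B = b₂(1+q)/b₁ ≤ 1`; quads uniformly close to
them are, read through `(H ∘ L)⁻¹` (uniformly continuous near the two rectangles), close to the
two charts, and `dominated_of_near_rect` applies.  (The one-parameter family
`s ↦ H ∘ rectMap (1-s) (1+s)` is thus strictly decreasing.) [cite: SchrammSmirnov2011, proof of Lemma 5.1 ("Then Q' < Q₀ < Q''")] -/
theorem strictlyDominated_rectQuad (H : ℂ ≃ₜ ℂ) {a₁ a₂ b₁ b₂ : ℝ} (ha₁ : 0 < a₁) (ha : a₁ < a₂)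
    (hb₂ : 0 < b₂) (hb : b₂ < b₁) (hD₁ : ∀ p : I × I, H (rectMap a₁ b₁ p) ∈ D)
    (hD₂ : ∀ p : I × I, H (rectMap a₂ b₂ p) ∈ D) :
    StrictlyDominated (rectQuad H a₁ b₁ ha₁ (hb₂.trans hb) hD₁)
      (rectQuad H a₂ b₂ (ha₁.trans ha) hb₂ hD₂) := by
  have ha₂ : 0 < a₂ := ha₁.trans ha
  have hb₁ : 0 < b₁ := hb₂.trans hb
  -- the shape parameter `q`
  have hpa : 0 < 1 - a₁ / a₂ := by
    have : a₁ / a₂ < 1 := (div_lt_one ha₂).2 ha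
    linarith
  have hpb : 0 < b₁ / b₂ - 1 := by
    have : 1 < b₁ / b₂ := (one_lt_div hb₂).2 hb
    linarith
  set q : ℝ := min (1 / 2) (min (1 - a₁ / a₂) (b₁ / b₂ - 1)) with hq_def
  have hq : 0 < q := lt_min (by norm_num) (lt_min hpa hpb)
  have hq' : q ≤ 1 / 2 := min_le_left _ _
  have hqa : q ≤ 1 - a₁ / a₂ := (min_le_right _ _).trans (min_le_left _ _)
  have hqb : q ≤ b₁ / b₂ - 1 := (min_le_right _ _).trans (min_le_right _ _)
  have h1q : (0 : ℝ) < 1 - q := by linarith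
  have h1q' : (0 : ℝ) < 1 + q := by linarith
  -- the scaling `L` and the straightening homeomorphism `H' = H ∘ L`
  set α : ℝ := a₁ / (1 - q) with hα
  set β : ℝ := b₁ / (1 + q) with hβ
  have hα₀ : 0 < α := div_pos ha₁ h1q
  have hβ₀ : 0 < β := div_pos hb₁ h1q'
  set L : ℂ ≃ₜ ℂ := scaleXY α β hα₀.ne' hβ₀.ne' with hL
  set H' : ℂ ≃ₜ ℂ := L.trans H with hH'
  set A : ℝ := a₂ / α with hA_def
  set B : ℝ := b₂ / β with hB_def
  have hαa : α * (1 - q) = a₁ := by rw [hα]; field_simp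
  have hβb : β * (1 + q) = b₁ := by rw [hβ]; field_simp
  have hαA : α * A = a₂ := by rw [hA_def]; field_simp
  have hβB : β * B = b₂ := by rw [hB_def]; field_simp
  have hA : 1 ≤ A := by
    rw [hA_def, le_div_iff₀ hα₀, one_mul, hα, div_le_iff₀ h1q]
    have h : a₁ / a₂ ≤ 1 - q := by linarith
    have := (div_le_iff₀ ha₂).1 h
    linarith
  have hB₀ : 0 < B := div_pos hb₂ hβ₀
  have hB : B ≤ 1 := by
    rw [hB_def, div_le_iff₀ hβ₀, one_mul, hβ, le_div_iff₀ h1q']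
    have h : 1 + q ≤ b₁ / b₂ := by linarith
    have := (le_div_iff₀ hb₂).1 h
    linarith
  -- the two quads read through `H'`
  have hQ₁ : ∀ p : I × I, H' (rectMap (1 - q) (1 + q) p) = H (rectMap a₁ b₁ p) := fun p => by
    rw [hH', Homeomorph.trans_apply, hL, scaleXY_rectMap, hαa, hβb]
  have hQ₂ : ∀ p : I × I, H' (rectMap A B p) = H (rectMap a₂ b₂ p) := fun p => by
    rw [hH', Homeomorph.trans_apply, hL, scaleXY_rectMap, hαA, hβB]
  -- uniform continuity of `H'⁻¹` near the two rectangles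
  set C : Set ℂ := range (rectMap (1 - q) (1 + q)) ∪ range (rectMap A B) with hC
  have hCc : IsCompact C :=
    (isCompact_range (continuous_rectMap _ _)).union (isCompact_range (continuous_rectMap _ _))
  set N := cthickening 1 (H' '' C) with hN
  have hNc : IsCompact N := (hCc.image H'.continuous).cthickening
  set η : ℝ := q / 8 with hη_def
  have hη : 0 < η := by positivity
  have hηq : 4 * η < q := by rw [hη_def]; linarith
  obtain ⟨δ', hδ', hHδ'⟩ := Metric.uniformContinuousOn_iff.1
    (hNc.uniformContinuousOn_of_continuous H'.symm.continuous.continuousOn) η hη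
  set r : ℝ := min 1 δ' with hr_def
  have hr : 0 < r := lt_min one_pos hδ'
  have hr1 : r ≤ 1 := min_le_left _ _
  have hrδ : r ≤ δ' := min_le_right _ _
  have key : ∀ x z : ℂ, z ∈ C → dist x (H' z) < r → ‖H'.symm x - z‖ ≤ η := by
    intro x z hz hxz
    have hHz : H' z ∈ N := self_subset_cthickening _ (mem_image_of_mem H' hz)
    have hx : x ∈ N := mem_cthickening_of_dist_le x (H' z) 1 _ (mem_image_of_mem H' hz)
      (hxz.le.trans hr1)
    have := hHδ' x hx (H' z) hHz (hxz.trans_le hrδ)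
    rw [H'.symm_apply_apply, dist_eq_norm] at this
    exact this.le
  refine strictlyDominated_iff.2 ⟨ball _ r, ball _ r, isOpen_ball, isOpen_ball,
    mem_ball_self hr, mem_ball_self hr, fun P hP P' hP' => ?_⟩
  refine dominated_of_near_rect H' hq' hη hηq hA hB₀ hB (fun p => ?_) (fun p => ?_)
  · refine key _ _ (Or.inr ⟨p, rfl⟩) ?_
    rw [hQ₂ p]
    exact (dist_apply_le P' (rectQuad H a₂ b₂ ha₂ hb₂ hD₂) p).trans_lt (mem_ball.1 hP')
  · refine key _ _ (Or.inl ⟨p, rfl⟩) ?_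
    rw [hQ₁ p]
    exact (dist_apply_le P (rectQuad H a₁ b₁ ha₁ hb₁ hD₁) p).trans_lt (mem_ball.1 hP)

/-! ### Rectangles near the square stay in `D` and near the quad -/

/-- **Room for the perturbations.**  If `H` extends the quad `Q` of the open set `D`
(`H ∘ rectMap 1 1 = Q`), then for every `ε > 0` there is `τ ∈ (0, 1/2]` such that for all
`a, b` within `τ` of `1` the rectangle `H ∘ rectMap a b` lies in `D` and is uniformly `ε`-close to
`Q` ("`Q', Q'' ∈ 𝒬_D` if `δ₀` is chosen sufficiently small"; uniform continuity of `H` on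
`[-2, 2]²` and compactness of `[Q] ⊆ D`). [cite: SchrammSmirnov2011, proof of Lemma 5.1] -/
theorem exists_rect_near (hD : IsOpen D) (Q : Quad D) (H : ℂ ≃ₜ ℂ)
    (hH : ∀ p : I × I, H (rectMap 1 1 p) = Q p) {ε : ℝ} (hε : 0 < ε) :
    ∃ τ : ℝ, 0 < τ ∧ τ ≤ 1 / 2 ∧ ∀ a b : ℝ, |a - 1| ≤ τ → |b - 1| ≤ τ →
      (∀ p : I × I, H (rectMap a b p) ∈ D) ∧ ∀ p : I × I, dist (H (rectMap a b p)) (Q p) < ε := by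
  -- room in `D` around `[Q]`
  obtain ⟨δD, hδD, hthick⟩ :=
    Q.isCompact_carrier.exists_cthickening_subset_open hD Q.carrier_subset
  -- uniform continuity of `H` on `C = [-2, 2]²`
  set C := Icc (-2 : ℝ) 2 ×ℂ Icc (-2 : ℝ) 2 with hC
  have hCc : IsCompact C := isCompact_rect 2 2
  have hεD : 0 < min ε δD := lt_min hε hδD
  obtain ⟨δ, hδ, hHδ⟩ := Metric.uniformContinuousOn_iff.1
    (hCc.uniformContinuousOn_of_continuous H.continuous.continuousOn) _ hεD
  refine ⟨min (1 / 2) (δ / 4), lt_min (by norm_num) (by linarith), min_le_left _ _,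
    fun a b ha hb => ?_⟩
  have hτδ : min (1 / 2 : ℝ) (δ / 4) ≤ δ / 4 := min_le_right _ _
  have hτ2 : min (1 / 2 : ℝ) (δ / 4) ≤ 1 / 2 := min_le_left _ _
  have ha2 : |a| ≤ 2 := by
    have := abs_le.1 (ha.trans hτ2)
    exact abs_le.2 ⟨by linarith [this.1], by linarith [this.2]⟩
  have hb2 : |b| ≤ 2 := by
    have := abs_le.1 (hb.trans hτ2)
    exact abs_le.2 ⟨by linarith [this.1], by linarith [this.2]⟩
  have h12 : |(1 : ℝ)| ≤ 2 := by norm_num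
  have hclose : ∀ p : I × I, dist (H (rectMap a b p)) (Q p) < min ε δD := fun p => by
    rw [← hH p]
    refine hHδ _ (rectMap_mem_rect_two ha2 hb2 p) _ (rectMap_mem_rect_two h12 h12 p) ?_
    rw [dist_eq_norm]
    calc ‖rectMap a b p - rectMap 1 1 p‖ ≤ |a - 1| + |b - 1| := norm_rectMap_sub_rectMap_le _ _ _ _ p
      _ ≤ δ / 4 + δ / 4 := add_le_add (ha.trans hτδ) (hb.trans hτδ)
      _ < δ := by linarith
  refine ⟨fun p => ?_, fun p => (hclose p).trans_le (min_le_left _ _)⟩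
  exact hthick (mem_cthickening_of_dist_le _ (Q p) _ _ ⟨p, rfl⟩
    ((hclose p).trans_le (min_le_right _ _)).le)

end Quad

/-! ### The boundary of a crossing event is sandwiched between perturbed crossing events -/

namespace QuadConfig

/-- **The topological sandwich of the proof of Lemma 5.1.**  If `Q' < Q₀ < Q_m < Q''` in `𝒬_D`,
then `∂⊞_{Q₀} ⊆ ⊞_{Q'} ∖ ⊞_{Q''}` in `ℋ_D`: on one side `∂⊞_{Q₀} ⊆ ⊞_{Q₀} ⊆ ⊞_{Q'}` (`⊞_{Q₀}` is
closed, configurations are lower sets); on the other side, with `U' = {Q : Q₀ < Q < Q''}` (open,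
and `Q_m ∈ U'`), "`⊞_{Q₀} ⊇ V_{U'} ⊇ ⊞_{Q''}` … hence the closure of `V^{Q₀}` is contained in
`V^{Q''}`", i.e. `⊞_{Q''} ⊆ V_{U'} ⊆ interior ⊞_{Q₀}`, which misses `∂⊞_{Q₀}`.
[cite: SchrammSmirnov2011, proof of Lemma 5.1] -/
theorem frontier_crossedEvent_subset_sdiff {Q' Q₀ Qm Q'' : Quad D}
    (h' : Quad.StrictlyDominated Q' Q₀) (hm : Quad.StrictlyDominated Q₀ Qm)
    (h'' : Quad.StrictlyDominated Qm Q'') :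
    frontier (crossedEvent Q₀) ⊆ crossedEvent Q' \ crossedEvent Q'' := by
  intro S hS
  refine ⟨?_, fun hS'' => ?_⟩
  · have h1 : S ∈ crossedEvent Q₀ := (isClosed_crossedEvent Q₀).frontier_subset hS
    exact S.isLowerQuadSet h1 h'
  · have hU : IsOpen {Q : Quad D | Quad.StrictlyDominated Q₀ Q ∧ Quad.StrictlyDominated Q Q''} :=
      (Quad.isOpen_setOf_strictlyDominated_right Q₀).inter
        (Quad.isOpen_setOf_strictlyDominated_left Q'')
    have hsub : someCrossed {Q : Quad D | Quad.StrictlyDominated Q₀ Q ∧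
        Quad.StrictlyDominated Q Q''} ⊆ crossedEvent Q₀ := by
      rintro T ⟨Q, hQT, hQ⟩
      exact T.isLowerQuadSet hQT hQ.1
    have hint : S ∈ interior (crossedEvent Q₀) :=
      interior_maximal hsub (isOpen_someCrossed hU) ⟨Qm, S.isLowerQuadSet hS'' h'', hm, h''⟩
    exact hS.2 hint

/-- Crossing events are antitone along `<`: `Q₁ < Q₂` gives `⊞_{Q₂} ⊆ ⊞_{Q₁}` (configurations are
lower sets). [cite: SchrammSmirnov2011, §1.3] -/
theorem crossedEvent_subset_of_strictlyDominated {Q₁ Q₂ : Quad D}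
    (h : Quad.StrictlyDominated Q₁ Q₂) : crossedEvent Q₂ ⊆ crossedEvent Q₁ :=
  fun S hS => S.isLowerQuadSet hS h

/-- Hence, for a finite measure `μ` on `ℋ_D`, `μ(∂⊞_{Q₀}) ≤ μ(⊞_{Q'}) - μ(⊞_{Q''})` whenever
`Q' < Q₀ < Q_m < Q''` (`⊞_{Q''} ⊆ ⊞_{Q'}`). [cite: SchrammSmirnov2011, proof of Lemma 5.1] -/
theorem measure_frontier_crossedEvent_le (μ : Measure (QuadConfig D)) [IsFiniteMeasure μ]
    {Q' Q₀ Qm Q'' : Quad D}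
    (h' : Quad.StrictlyDominated Q' Q₀) (hm : Quad.StrictlyDominated Q₀ Qm)
    (h'' : Quad.StrictlyDominated Qm Q'') :
    μ (frontier (crossedEvent Q₀)) ≤ μ (crossedEvent Q') - μ (crossedEvent Q'') := by
  have hsub : crossedEvent Q'' ⊆ crossedEvent Q' :=
    crossedEvent_subset_of_strictlyDominated ((h'.trans hm).trans h'')
  calc μ (frontier (crossedEvent Q₀)) ≤ μ (crossedEvent Q' \ crossedEvent Q'') :=
        measure_mono (frontier_crossedEvent_subset_sdiff h' hm h'')
    _ = μ (crossedEvent Q') - μ (crossedEvent Q'') :=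
        measure_sdiff hsub (measurableSet_crossedEvent _).nullMeasurableSet (measure_ne_top μ _)

end QuadConfig

namespace Quad

/-! ### The one-parameter family `s ↦ H ∘ rectMap (1 - s) (1 + s)` -/

/-- The clamp of `s` to `[0, τ]`. [folklore] -/
def clampTo (τ s : ℝ) : ℝ := max 0 (min τ s)

/-- `clampTo τ s ∈ [0, τ]` for `τ ≥ 0`. [folklore] -/
theorem clampTo_mem {τ : ℝ} (hτ : 0 ≤ τ) (s : ℝ) : 0 ≤ clampTo τ s ∧ clampTo τ s ≤ τ :=
  ⟨le_max_left _ _, max_le hτ (min_le_left _ _)⟩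

/-- `clampTo τ s = s` for `s ∈ [0, τ]`. [folklore] -/
theorem clampTo_of_mem {τ s : ℝ} (h0 : 0 ≤ s) (h1 : s ≤ τ) : clampTo τ s = s := by
  rw [clampTo, min_eq_right h1, max_eq_right h0]

/-- `clampTo τ` is monotone. [folklore] -/
theorem clampTo_mono (τ : ℝ) : Monotone (clampTo τ) := fun _ _ hst =>
  max_le_max le_rfl (min_le_min le_rfl hst)

/-- `|(1 - clampTo τ s) - 1| ≤ τ`. [folklore] -/
theorem abs_one_sub_clampTo_sub_one_le {τ : ℝ} (hτ : 0 ≤ τ) (s : ℝ) :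
    |1 - clampTo τ s - 1| ≤ τ := by
  rw [sub_sub_cancel_left, abs_neg, abs_of_nonneg (clampTo_mem hτ s).1]
  exact (clampTo_mem hτ s).2

/-- `|(1 + clampTo τ s) - 1| ≤ τ`. [folklore] -/
theorem abs_one_add_clampTo_sub_one_le {τ : ℝ} (hτ : 0 ≤ τ) (s : ℝ) :
    |1 + clampTo τ s - 1| ≤ τ := by
  rw [add_sub_cancel_left, abs_of_nonneg (clampTo_mem hτ s).1]
  exact (clampTo_mem hτ s).2

/-- **Schramm–Smirnov's perturbations `Q^{q_s}` of a quad as a one-parameter family**: for `H` a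
homeomorphism of the plane (extending `Q₀ = H ∘ rectMap 1 1`) and `τ ≤ 1/2` such that the
rectangles `H ∘ rectMap a b`, `|a - 1|, |b - 1| ≤ τ`, lie in `D`, the quad
`s ↦ H ∘ rectMap (1 - s) (1 + s)` of `D` (the parameter clamped to `[0, τ]`), which is strictly
DEcreasing in `s` for Schramm–Smirnov's order (`strictlyDominated_shrinkFamily`).
[cite: SchrammSmirnov2011, proof of Lemma 5.1 (the quads Q^{q_s})] -/
def shrinkFamily (H : ℂ ≃ₜ ℂ) {τ : ℝ} (hτ₀ : 0 ≤ τ) (hτ : τ ≤ 1 / 2)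
    (hmem : ∀ a b : ℝ, |a - 1| ≤ τ → |b - 1| ≤ τ → ∀ p : I × I, H (rectMap a b p) ∈ D) (s : ℝ) :
    Quad D :=
  rectQuad H (1 - clampTo τ s) (1 + clampTo τ s)
    (by have := (clampTo_mem hτ₀ s).2; linarith) (by have := (clampTo_mem hτ₀ s).1; linarith)
    (hmem _ _ (abs_one_sub_clampTo_sub_one_le hτ₀ s) (abs_one_add_clampTo_sub_one_le hτ₀ s))

section Family

variable (H : ℂ ≃ₜ ℂ) {τ : ℝ} (hτ₀ : 0 ≤ τ) (hτ : τ ≤ 1 / 2)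
  (hmem : ∀ a b : ℝ, |a - 1| ≤ τ → |b - 1| ≤ τ → ∀ p : I × I, H (rectMap a b p) ∈ D)

/-- `shrinkFamily_apply`: structural lemma. [folklore] -/
theorem shrinkFamily_apply (s : ℝ) (p : I × I) :
    shrinkFamily H hτ₀ hτ hmem s p = H (rectMap (1 - clampTo τ s) (1 + clampTo τ s) p) := rfl

/-- Members of the family with the same clamped parameter coincide. [folklore] -/
theorem shrinkFamily_congr {s t : ℝ} (h : clampTo τ s = clampTo τ t) :
    shrinkFamily H hτ₀ hτ hmem s = shrinkFamily H hτ₀ hτ hmem t :=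
  Quad.ext fun p => by rw [shrinkFamily_apply, shrinkFamily_apply, h]

/-- **The family is strictly decreasing**: a larger parameter gives a strictly narrower and taller
rectangle, hence a strictly smaller quad (`strictlyDominated_rectQuad`).
[cite: SchrammSmirnov2011, proof of Lemma 5.1 ("Then Q' < Q₀ < Q''")] -/
theorem strictlyDominated_shrinkFamily {s t : ℝ} (h : clampTo τ s < clampTo τ t) :
    StrictlyDominated (shrinkFamily H hτ₀ hτ hmem t) (shrinkFamily H hτ₀ hτ hmem s) :=
  strictlyDominated_rectQuad H _ (by linarith) _ (by linarith) _ _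

/-- Hence the crossing events `⊞_{Q_s}` increase with `s`. [cite: SchrammSmirnov2011, proof of Lemma 5.1] -/
theorem monotone_crossedEvent_shrinkFamily :
    Monotone fun s => QuadConfig.crossedEvent (shrinkFamily H hτ₀ hτ hmem s) := by
  intro s t hst
  show QuadConfig.crossedEvent (shrinkFamily H hτ₀ hτ hmem s) ⊆
    QuadConfig.crossedEvent (shrinkFamily H hτ₀ hτ hmem t)
  rcases (clampTo_mono τ hst).lt_or_eq with hlt | heq
  · exact QuadConfig.crossedEvent_subset_of_strictlyDominated
      (strictlyDominated_shrinkFamily H hτ₀ hτ hmem hlt)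
  · rw [shrinkFamily_congr H hτ₀ hτ hmem heq]

end Family

/-! ### Null boundary of crossing events for a dense set of quads (the soft form of Lemma 5.1) -/

/-- **Crossing events of a dense set of quads are continuity sets — for EVERY finite measure on
`ℋ_D`.**  For `D` open, `μ` a finite Borel measure on `ℋ_D`, `Q ∈ 𝒬_D` and `ε > 0` there is a quad
`Q' < Q` with `d(Q', Q) < ε` and `μ(∂⊞_{Q'}) = 0`.  Proof: along Schramm–Smirnov's perturbations
`Q_s = Q̂(q_s)` (`shrinkFamily`, `s ∈ (0, τ)`, all within `ε` of `Q` and in `D` by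
`exists_rect_near`) the crossing events increase, so `s ↦ μ(⊞_{Q_s})` is monotone, hence
continuous off a countable set (`Monotone.countable_not_continuousAt`); at a continuity point
`s₀ ∈ (0, τ)` the sandwich `∂⊞_{Q_{s₀}} ⊆ ⊞_{Q_t} ∖ ⊞_{Q_s}` (`s < s₀ < t`,
`measure_frontier_crossedEvent_le`, the topological half of the printed proof of Lemma 5.1) gives
`μ(∂⊞_{Q_{s₀}}) ≤ μ(⊞_{Q_t}) - μ(⊞_{Q_s}) → 0`.  This is what the proof of Theorem 1.7 uses of
Lemma 5.1 at the quad `Q₀` ("since such collection of quads is dense in `𝒬_D`"), obtained here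
without the Russo–Seymour–Welsh estimate of Lemma 6.1 — which is needed in print only to treat
EVERY quad (continuity of `s ↦ μ(⊞_{Q_s})` at the given parameter).
[cite: SchrammSmirnov2011, Lemma 5.1 (proof) and proof of Thm. 1.7] -/
theorem exists_strictlyDominated_measure_frontier_eq_zero (hD : IsOpen D)
    (μ : Measure (QuadConfig D)) [IsFiniteMeasure μ] (Q : Quad D) {ε : ℝ} (hε : 0 < ε) :
    ∃ Q' : Quad D, dist Q' Q < ε ∧ StrictlyDominated Q' Q ∧
      μ (frontier (QuadConfig.crossedEvent Q')) = 0 := by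
  obtain ⟨H, hH⟩ := exists_homeomorph_extend Q
  have hH1 : ∀ p : I × I, H (rectMap 1 1 p) = Q p := fun p => by rw [rectMap_one_one]; exact hH p
  obtain ⟨τ, hτ, hτ2, hroom⟩ := exists_rect_near hD Q H hH1 (half_pos hε)
  -- the family and the monotone function
  set fam : ℝ → Quad D := shrinkFamily H hτ.le hτ2 (fun a b ha hb => (hroom a b ha hb).1)
    with hfam
  set g : ℝ → ℝ := fun s => (μ (QuadConfig.crossedEvent (fam s))).toReal with hg
  have hgmono : Monotone g := fun s t hst =>
    ENNReal.toReal_mono (measure_ne_top _ _)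
      (measure_mono (monotone_crossedEvent_shrinkFamily H hτ.le hτ2 _ hst))
  -- a continuity point `s₀ ∈ (0, τ)`
  have hcount : {x | ¬ContinuousAt g x}.Countable := hgmono.countable_not_continuousAt
  obtain ⟨s₀, hs₀, hs₀c⟩ : (Ioo 0 τ ∩ {x | ¬ContinuousAt g x}ᶜ).Nonempty :=
    (hcount.dense_compl ℝ).inter_open_nonempty _ isOpen_Ioo (nonempty_Ioo.2 hτ)
  have hcont : ContinuousAt g s₀ := not_not.1 hs₀c
  have hcl : ∀ {s : ℝ}, 0 ≤ s → s ≤ τ → clampTo τ s = s := fun h0 h1 => clampTo_of_mem h0 h1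
  -- the boundary of `⊞_{Q_{s₀}}` is null
  have hnull : μ (frontier (QuadConfig.crossedEvent (fam s₀))) = 0 := by
    refine ((ENNReal.toReal_eq_zero_iff _).1
      (le_antisymm (le_of_forall_pos_le_add fun δ' hδ' => ?_) ENNReal.toReal_nonneg)).resolve_right
      (measure_ne_top _ _)
    rw [zero_add]
    obtain ⟨ρ, hρ, hgρ⟩ := Metric.continuousAt_iff.1 hcont (δ' / 2) (half_pos hδ')
    set ρ' : ℝ := min ρ (min s₀ (τ - s₀)) / 2 with hρ'
    have hρ'₀ : 0 < ρ' := by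
      have : 0 < min ρ (min s₀ (τ - s₀)) := lt_min hρ (lt_min hs₀.1 (by linarith [hs₀.2]))
      rw [hρ']; linarith
    have hρ'ρ : ρ' < ρ := by
      have := min_le_left ρ (min s₀ (τ - s₀)); rw [hρ']; linarith
    have hρ's : ρ' < s₀ := by
      have := (min_le_right ρ _).trans (min_le_left s₀ (τ - s₀)); rw [hρ']; linarith
    have hρ'τ : ρ' < τ - s₀ := by
      have := (min_le_right ρ _).trans (min_le_right s₀ (τ - s₀)); rw [hρ']; linarith
    set s : ℝ := s₀ - ρ' with hs_def
    set t : ℝ := s₀ + ρ' with ht_def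
    set m : ℝ := (s + s₀) / 2 with hm_def
    have h0s : 0 < s := by rw [hs_def]; linarith
    have hsm : s < m := by rw [hm_def]; linarith
    have hms₀ : m < s₀ := by rw [hm_def]; linarith
    have hs₀t : s₀ < t := by rw [ht_def]; linarith
    have htτ : t < τ := by rw [ht_def]; linarith
    -- the sandwich `Q_t < Q_{s₀} < Q_m < Q_s`
    have h1 : StrictlyDominated (fam t) (fam s₀) :=
      strictlyDominated_shrinkFamily H hτ.le hτ2 _
        (by rw [hcl hs₀.1.le hs₀.2.le, hcl (by linarith) htτ.le]; exact hs₀t)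
    have h2 : StrictlyDominated (fam s₀) (fam m) :=
      strictlyDominated_shrinkFamily H hτ.le hτ2 _
        (by rw [hcl hs₀.1.le hs₀.2.le, hcl (by linarith) (by linarith)]; exact hms₀)
    have h3 : StrictlyDominated (fam m) (fam s) :=
      strictlyDominated_shrinkFamily H hτ.le hτ2 _
        (by rw [hcl h0s.le (by linarith), hcl (by linarith) (by linarith)]; exact hsm)
    have hle := QuadConfig.measure_frontier_crossedEvent_le μ h1 h2 h3
    have hst : μ (QuadConfig.crossedEvent (fam s)) ≤ μ (QuadConfig.crossedEvent (fam t)) :=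
      measure_mono (monotone_crossedEvent_shrinkFamily H hτ.le hτ2 _ (by linarith : s ≤ t))
    have hgs : dist (g s) (g s₀) < δ' / 2 := hgρ (by rw [dist_eq_norm, hs_def]; simp [abs_of_pos hρ'₀, hρ'ρ])
    have hgt : dist (g t) (g s₀) < δ' / 2 := hgρ (by rw [dist_eq_norm, ht_def]; simp [abs_of_pos hρ'₀, hρ'ρ])
    rw [Real.dist_eq, abs_lt] at hgs hgt
    calc (μ (frontier (QuadConfig.crossedEvent (fam s₀)))).toReal
        ≤ (μ (QuadConfig.crossedEvent (fam t)) - μ (QuadConfig.crossedEvent (fam s))).toReal :=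
          ENNReal.toReal_mono (ENNReal.sub_ne_top (measure_ne_top _ _)) hle
      _ = g t - g s := by rw [hg]; exact ENNReal.toReal_sub_of_le hst (measure_ne_top _ _)
      _ ≤ δ' := by linarith [hgs.1, hgt.2]
  -- `Q_{s₀}` is within `ε` of `Q` and strictly smaller than `Q = Q_0`
  have hQ0 : fam 0 = Q := Quad.ext fun p => by
    rw [hfam, shrinkFamily_apply, clampTo_of_mem le_rfl hτ.le, sub_zero, add_zero, hH1]
  refine ⟨fam s₀, ?_, ?_, hnull⟩
  · rw [dist_eq]
    have : dist (fam s₀).toContinuousMap Q.toContinuousMap < ε / 2 := by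
      refine (ContinuousMap.dist_lt_iff (half_pos hε)).2 fun p => ?_
      simp only [toContinuousMap_apply, hfam, shrinkFamily_apply]
      exact (hroom _ _ (abs_one_sub_clampTo_sub_one_le hτ.le s₀)
        (abs_one_add_clampTo_sub_one_le hτ.le s₀)).2 p
    linarith
  · rw [← hQ0]
    exact strictlyDominated_shrinkFamily H hτ.le hτ2 _
      (by rw [hcl le_rfl hτ.le, hcl hs₀.1.le hs₀.2.le]; exact hs₀.1)

/-- **The quads whose crossing event is a `μ`-continuity set are dense in `𝒬_D`** (`D` open, `μ`
any finite Borel measure on `ℋ_D`). [cite: SchrammSmirnov2011, Lemma 5.1 and proof of Thm. 1.7] -/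
theorem dense_setOf_measure_frontier_crossedEvent_eq_zero (hD : IsOpen D)
    (μ : Measure (QuadConfig D)) [IsFiniteMeasure μ] :
    Dense {Q : Quad D | μ (frontier (QuadConfig.crossedEvent Q)) = 0} :=
  Metric.dense_iff.2 fun Q ε hε => by
    obtain ⟨Q', hd, -, h0⟩ := exists_strictlyDominated_measure_frontier_eq_zero hD μ Q hε
    exact ⟨Q', mem_ball.2 hd, h0⟩

/-- Every quad is a limit of strictly smaller quads whose crossing events are `μ`-continuity sets
(a refinement of condition `(3.2)`, `mem_closure_setOf_strictlyDominated`).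
[cite: SchrammSmirnov2011, §3 (3.2) and Lemma 5.1] -/
theorem mem_closure_setOf_strictlyDominated_null (hD : IsOpen D) (μ : Measure (QuadConfig D))
    [IsFiniteMeasure μ] (Q : Quad D) :
    Q ∈ closure {Q' | StrictlyDominated Q' Q ∧ μ (frontier (QuadConfig.crossedEvent Q')) = 0} := by
  refine Metric.mem_closure_iff.2 fun ε hε => ?_
  obtain ⟨Q', hd, hlt, h0⟩ := exists_strictlyDominated_measure_frontier_eq_zero hD μ Q hε
  exact ⟨Q', ⟨hlt, h0⟩, by rwa [dist_comm]⟩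

end Quad

/-! ### Corollary 5.2 and (5.2) at continuity quads; Theorem 1.7 from the mesh-independent gluing -/

/-- **Corollary 5.2 for finitely many continuity quads** ("If `𝓜 ⊂ ℋ_D` is in the Boolean algebra
generated by finitely many of the events `⊞_Q` … then `μ(𝓜) = lim μ_η(𝓜)`"), in the form that
needs Lemma 5.1 only for the quads at hand: if `μs → μ` weakly (finite measures on `ℋ_D`, `D` open
nonempty — metrizable by Thm. 1.4 (1), `SchrammSmirnov2011_thm_1_4_holds`) and `μ(∂⊞_Q) = 0` for
the finitely many `Q ∈ F`, then `μs i (E) → μ(E)` for every `E ∈ σ(⊞_Q : Q ∈ F)`.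
[cite: SchrammSmirnov2011, Cor. 5.2] -/
theorem tendsto_measure_of_null_frontier_generateFrom (hD : IsOpen D) (hne : D.Nonempty)
    {ι : Type*} {L : Filter ι} {μ : FiniteMeasure (QuadConfig D)}
    {μs : ι → FiniteMeasure (QuadConfig D)} (hlim : Tendsto μs L (𝓝 μ)) {F : Set (Quad D)}
    (hF : F.Finite)
    (hF₀ : ∀ Q ∈ F, (μ : Measure (QuadConfig D)) (frontier (QuadConfig.crossedEvent Q)) = 0)
    {E : Set (QuadConfig D)}
    (hE : MeasurableSet[MeasurableSpace.generateFrom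
      ((fun Q => QuadConfig.crossedEvent Q) '' F)] E) :
    Tendsto (fun i => (μs i : Measure (QuadConfig D)) E) L
      (𝓝 ((μ : Measure (QuadConfig D)) E)) := by
  haveI := hasOuterApproxClosed_of_thm_1_4 SchrammSmirnov2011_thm_1_4_holds hD hne
  haveI : Nonempty (QuadConfig D) := ⟨QuadConfig.none⟩
  refine finiteMeasure_tendsto_measure_of_null_frontier' hlim ?_
  refine measure_frontier_eq_zero_of_generateFrom_finite _ (hF.image _) ?_ hE
  rintro _ ⟨Q, hQ, rfl⟩
  exact hF₀ Q hQ

/-- **(5.2) at a continuity quad, from the mesh-independent gluing with continuity quads.**  Let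
`μs k → μ` weakly in `ℋ_D` (`D` open nonempty), `Q₀ ∈ 𝒬_D` with `μ(∂⊞_{Q₀}) = 0`, and suppose
(the conclusion of Prop. 4.1 for `Q₀` and the region `U`, with its quads taken among the
`μ`-continuity quads — a dense set, `Quad.dense_setOf_measure_frontier_crossedEvent_eq_zero`):
for every `ε > 0` there are finitely many quads `F` inside `U` with `μ(∂⊞_Q) = 0` and
`W ∈ σ(⊞_Q : Q ∈ F)` with `limsup_k μs_k(W ∆ ⊞_{Q₀}) ≤ ε`.  Then `⊞_{Q₀}` is `μ`-a.e. equal to an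
`𝓕_U`-measurable set — by Cor. 5.2 in `σ(⊞_Q : Q ∈ F ∪ {Q₀})`
(`tendsto_measure_of_null_frontier_generateFrom`) and `exists_measurableSet_ae_eq_of_forall_approx`.
No named fact enters. [cite: SchrammSmirnov2011, proof of Thm. 1.7 (eq. (5.2)), Prop. 4.1, Cor. 5.2] -/
theorem exists_measurableSet_crossingField_ae_eq_of_gluing_of_null_frontier (hD : IsOpen D)
    (hne : D.Nonempty) {μ : FiniteMeasure (QuadConfig D)} {μs : ℕ → FiniteMeasure (QuadConfig D)}
    (hlim : Tendsto μs atTop (𝓝 μ)) {U : Set ℂ} {Q₀ : Quad D}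
    (hQ₀ : (μ : Measure (QuadConfig D)) (frontier (QuadConfig.crossedEvent Q₀)) = 0)
    (h41 : ∀ ε : ℝ, 0 < ε → ∃ (F : Set (Quad D)) (W : Set (QuadConfig D)), F.Finite ∧
      (∀ Q ∈ F, Q.carrier ⊆ U ∧
        (μ : Measure (QuadConfig D)) (frontier (QuadConfig.crossedEvent Q)) = 0) ∧
      MeasurableSet[MeasurableSpace.generateFrom ((fun Q => QuadConfig.crossedEvent Q) '' F)] W ∧
      limsup (fun k => (μs k : Measure (QuadConfig D)) (W ∆ QuadConfig.crossedEvent Q₀)) atTop ≤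
        ENNReal.ofReal ε) :
    ∃ t, MeasurableSet[crossingField U] t ∧
      QuadConfig.crossedEvent Q₀ =ᵐ[(μ : Measure (QuadConfig D))] t := by
  refine exists_measurableSet_ae_eq_of_forall_approx fun ε hε => ?_
  obtain ⟨F, W, hF, hFU, hW, hlimsup⟩ := h41 ε hε
  refine ⟨W, ?_, ?_⟩
  · refine (MeasurableSpace.generateFrom_mono ?_) W hW
    rintro _ ⟨Q, hQ, rfl⟩
    exact ⟨Q, (hFU Q hQ).1, rfl⟩
  · have hmeas : MeasurableSet[MeasurableSpace.generateFrom
        ((fun Q => QuadConfig.crossedEvent Q) '' insert Q₀ F)]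
          (QuadConfig.crossedEvent Q₀ ∆ W) := by
      refine MeasurableSet.symmDiff
        (MeasurableSpace.measurableSet_generateFrom ⟨Q₀, mem_insert _ _, rfl⟩) ?_
      exact MeasurableSpace.generateFrom_mono (image_mono (subset_insert _ _)) W hW
    have h₀ : ∀ Q ∈ insert Q₀ F,
        (μ : Measure (QuadConfig D)) (frontier (QuadConfig.crossedEvent Q)) = 0 := by
      rintro Q (rfl | hQ)
      · exact hQ₀
      · exact (hFU Q hQ).2
    have ht := tendsto_measure_of_null_frontier_generateFrom hD hne hlim (hF.insert Q₀) h₀ hmeas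
    rw [← ht.limsup_eq, symmDiff_comm]
    exact hlimsup

/-- **Theorem 1.7 from Proposition 4.1 (mesh-independent gluing) at continuity quads.**  The
printed proof of Thm. 1.7 (p. 21): for `Q₀` in a dense set of quads, Prop. 4.1 and Cor. 5.2 give
`⊞_{Q₀} ∈ 𝓕_{D∖α}` mod `μ` (5.2), and Thm. 1.4 (2) concludes.  Here the dense set is the set of
`μ`-continuity quads (`Quad.dense_setOf_measure_frontier_crossedEvent_eq_zero`, replacing Lemma 5.1),
Thm. 1.4 is `SchrammSmirnov2011_thm_1_4_holds`, and what is ASSUMED is exactly the conclusion of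
Prop. 4.1 [SS11 §4: for every `ε > 0` a finite set `𝒬_ε` of quads in `D ∖ α` and
`𝓦_ε ∈ σ(⊞_Q : Q ∈ 𝒬_ε)` with `limsup_{η→0} μ_η(𝓦_ε ∆ ⊞_{Q₀}) < ε`] along the meshes of the
subsequential limit, at the `μ`-continuity quads `Q₀`, with `𝒬_ε` taken among the `μ`-continuity
quads.  Prop. 4.1 ("the most technically difficult part of our paper", resting on the discrete
gluing Thm. 1.1, the RSW/pivotal Assumptions 1.1 — for bond-`ℤ²` Garban's appendix — and
Lemmas 6.1–6.2) is NOT proved here and is not stated as a fact (D-0026).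
[cite: SchrammSmirnov2011, Thm. 1.7 (proof, p. 21) and Prop. 4.1] -/
theorem SchrammSmirnov2011_thm_1_7_of_gluing
    (h41 : ∀ (D : Set ℂ), IsOpen D → IsConnected D →
      ∀ (μ : FiniteMeasure (QuadConfig D)) (δs : ℕ → ℝ), (∀ k, 0 < δs k) →
        Tendsto δs atTop (𝓝 0) → Tendsto (fun k => squareCrossingLaw D (δs k)) atTop (𝓝 μ) →
      ∀ α : Set ℂ, IsFiniteLengthPathUnion α →
      ∀ Q₀ : Quad D,
        (μ : Measure (QuadConfig D)) (frontier (QuadConfig.crossedEvent Q₀)) = 0 →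
      ∀ ε : ℝ, 0 < ε → ∃ (F : Set (Quad D)) (W : Set (QuadConfig D)), F.Finite ∧
        (∀ Q ∈ F, Q.carrier ⊆ D \ α ∧
          (μ : Measure (QuadConfig D)) (frontier (QuadConfig.crossedEvent Q)) = 0) ∧
        MeasurableSet[MeasurableSpace.generateFrom
          ((fun Q => QuadConfig.crossedEvent Q) '' F)] W ∧
        limsup (fun k => (squareCrossingLaw D (δs k) : Measure (QuadConfig D))
          (W ∆ QuadConfig.crossedEvent Q₀)) atTop ≤ ENNReal.ofReal ε) :
    SchrammSmirnov2011_thm_1_7 := by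
  intro D hD hD' μ hμ α hα
  obtain ⟨δs, hpos, h0, hlim⟩ := hμ
  refine aeIncluded_iSup_crossingField_of_dense SchrammSmirnov2011_thm_1_4_holds hD hD'.nonempty
    _ α (Quad.dense_setOf_measure_frontier_crossedEvent_eq_zero hD (μ : Measure (QuadConfig D)))
    fun Q₀ hQ₀ => ?_
  exact exists_measurableSet_crossingField_ae_eq_of_gluing_of_null_frontier hD hD'.nonempty hlim
    hQ₀ (h41 D hD hD' μ δs hpos h0 hlim α hα Q₀ hQ₀)

/-- **Theorem 1.7 from Lemma 5.1 and Proposition 4.1 as printed.**  With Lemma 5.1 (the named fact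
`SchrammSmirnov2011_lemma_5_1`: EVERY crossing event is a continuity set of every subsequential
limit) the continuity provisos disappear and the assumption is Prop. 4.1 verbatim (for every quad
`Q₀` of `D`, along the meshes of the limit).
[cite: SchrammSmirnov2011, Thm. 1.7 (proof, p. 21), Prop. 4.1, Lemma 5.1] -/
theorem SchrammSmirnov2011_thm_1_7_of_lemma_5_1_of_gluing (h51 : SchrammSmirnov2011_lemma_5_1)
    (h41 : ∀ (D : Set ℂ), IsOpen D → IsConnected D →
      ∀ (μ : FiniteMeasure (QuadConfig D)) (δs : ℕ → ℝ), (∀ k, 0 < δs k) →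
        Tendsto δs atTop (𝓝 0) → Tendsto (fun k => squareCrossingLaw D (δs k)) atTop (𝓝 μ) →
      ∀ α : Set ℂ, IsFiniteLengthPathUnion α →
      ∀ Q₀ : Quad D, ∀ ε : ℝ, 0 < ε → ∃ (F : Set (Quad D)) (W : Set (QuadConfig D)), F.Finite ∧
        (∀ Q ∈ F, Q.carrier ⊆ D \ α) ∧
        MeasurableSet[MeasurableSpace.generateFrom
          ((fun Q => QuadConfig.crossedEvent Q) '' F)] W ∧
        limsup (fun k => (squareCrossingLaw D (δs k) : Measure (QuadConfig D))
          (W ∆ QuadConfig.crossedEvent Q₀)) atTop ≤ ENNReal.ofReal ε) :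
    SchrammSmirnov2011_thm_1_7 := by
  intro D hD hD' μ hμ α hα
  obtain ⟨δs, hpos, h0, hlim⟩ := hμ
  exact aeIncluded_iSup_crossingField_of_dense SchrammSmirnov2011_thm_1_4_holds hD hD'.nonempty
    _ α dense_univ fun Q₀ _ =>
      h51.exists_measurableSet_crossingField_ae_eq_of_gluing SchrammSmirnov2011_thm_1_4_holds hD
        hD'.nonempty hpos h0 hlim Q₀ (h41 D hD hD' μ δs hpos h0 hlim α hα Q₀)


/-! ### The endgame of Proposition 4.1: from an `L²` bound to an event; finitely many events and a sub-subsequence -/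

section Endgame

/-- **From an `L²`-approximation by a function to an approximating event** (the step "this proves
that there is an `𝓕_T`-measurable event `𝓦` such that `P(𝓦 ∆ ⊞_{Q₀}) < ε/2`" after
`‖Y₀ - Ỹ_T‖₂ < 6√ε₀` in the proof of Prop. 4.1; `𝓦 = {Ỹ_T > 1/2}` is `𝓕_T`-measurable when `Ỹ_T`
is): for a finite measure, an event `A` and a real function `Z` with `(𝟙_A - Z)²` integrable,
`μ(A ∆ {Z > 1/2}) ≤ 4 ∫ (𝟙_A - Z)² dμ` — on the symmetric difference `(𝟙_A - Z)² ≥ 1/4`, then Markov.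
[cite: SchrammSmirnov2011, proof of Prop. 4.1 ("Final estimates")] -/
theorem measureReal_symmDiff_setOf_lt_le_integral_sq {Ω : Type*} [MeasurableSpace Ω] (μ : Measure Ω)
    [IsFiniteMeasure μ] {A : Set Ω} {Z : Ω → ℝ}
    (hint : Integrable (fun ω => (A.indicator (1 : Ω → ℝ) ω - Z ω) ^ 2) μ) :
    μ.real (A ∆ {ω | 1 / 2 < Z ω}) ≤ 4 * ∫ ω, (A.indicator (1 : Ω → ℝ) ω - Z ω) ^ 2 ∂μ := by
  have hsub : A ∆ {ω | 1 / 2 < Z ω} ⊆ {ω | 1 / 4 ≤ (A.indicator (1 : Ω → ℝ) ω - Z ω) ^ 2} := by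
    intro ω hω
    simp only [mem_setOf_eq]
    rcases (Set.mem_symmDiff).1 hω with ⟨hA, hZ⟩ | ⟨hZ, hA⟩
    · have hZ' : Z ω ≤ 1 / 2 := not_lt.1 hZ
      rw [Set.indicator_of_mem hA, Pi.one_apply]
      nlinarith
    · have hZ' : 1 / 2 < Z ω := hZ
      have hA' : ω ∉ A := hA
      rw [Set.indicator_of_notMem hA', zero_sub, neg_sq]
      nlinarith
  have hmarkov := mul_meas_ge_le_integral_of_nonneg (ae_of_all _ fun ω => sq_nonneg _) hint (1 / 4)
  calc μ.real (A ∆ {ω | 1 / 2 < Z ω})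
      ≤ μ.real {ω | 1 / 4 ≤ (A.indicator (1 : Ω → ℝ) ω - Z ω) ^ 2} :=
        measureReal_mono hsub (measure_ne_top _ _)
    _ ≤ 4 * ∫ ω, (A.indicator (1 : Ω → ℝ) ω - Z ω) ^ 2 ∂μ := by linarith

/-- Pigeonhole along a filter: if frequently some index of a finite type works, then some index
works frequently ("there are finitely many possibilities for the event `𝓦`, and one of those works
for a sub-subsequence"). [cite: SchrammSmirnov2011, proof of Prop. 4.1 (last paragraph)] -/
theorem exists_frequently_of_frequently_exists {ι α : Type*} [Finite ι] {l : Filter α}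
    {p : α → ι → Prop} (h : ∃ᶠ x in l, ∃ i, p x i) : ∃ i, ∃ᶠ x in l, p x i := by
  by_contra hc
  push Not at hc
  have hev : ∀ᶠ x in l, ∀ i, ¬p x i := Filter.eventually_all.2 hc
  obtain ⟨x, hx, i, hi⟩ := (hev.and_frequently h).exists
  exact hx i hi

variable {D : Set ℂ}

/-- **Events of finitely many crossing events are read off the truth table**: every set measurable
with respect to `σ(⊞_Q : Q ∈ F)` is the preimage of a set of subsets of `F` under
`S ↦ {Q ∈ F : Q ∈ S}`.  (For `F` finite there are finitely many such sets — "since `𝓕_T` is finite,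
there are finitely many possibilities for the event `𝓦`".) [cite: SchrammSmirnov2011, proof of Prop. 4.1 (last paragraph)] -/
theorem exists_eq_preimage_of_measurableSet_generateFrom_crossedEvent {F : Set (Quad D)}
    {W : Set (QuadConfig D)}
    (hW : MeasurableSet[MeasurableSpace.generateFrom ((fun Q => QuadConfig.crossedEvent Q) '' F)] W) :
    ∃ T : Set (Set F), W = (fun S : QuadConfig D => {Q : F | (Q : Quad D) ∈ S}) ⁻¹' T := by
  induction W, hW using MeasurableSpace.generateFrom_induction with
  | hC t ht _ =>
    obtain ⟨Q, hQ, rfl⟩ := ht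
    refine ⟨{A | (⟨Q, hQ⟩ : F) ∈ A}, ?_⟩
    ext S
    simp only [QuadConfig.mem_crossedEvent, mem_preimage, mem_setOf_eq]
  | empty => exact ⟨∅, by rw [preimage_empty]⟩
  | compl t _ ih =>
    obtain ⟨T, rfl⟩ := ih
    exact ⟨Tᶜ, by rw [preimage_compl]⟩
  | iUnion f _ ih =>
    choose T hT using ih
    refine ⟨⋃ n, T n, ?_⟩
    rw [preimage_iUnion]
    exact iUnion_congr hT

/-- Conversely every such preimage is `σ(⊞_Q : Q ∈ F)`-measurable when `F` is finite (the truth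
table map is measurable into the finite discrete space of subsets of `F`). [folklore] -/
theorem measurableSet_preimage_generateFrom_crossedEvent {F : Set (Quad D)} (hF : F.Finite)
    (T : Set (Set F)) :
    MeasurableSet[MeasurableSpace.generateFrom ((fun Q => QuadConfig.crossedEvent Q) '' F)]
      ((fun S : QuadConfig D => {Q : F | (Q : Quad D) ∈ S}) ⁻¹' T) := by
  haveI : Finite F := hF.to_subtype
  letI mF : MeasurableSpace (QuadConfig D) :=
    MeasurableSpace.generateFrom ((fun Q => QuadConfig.crossedEvent Q) '' F)
  have hmeas : Measurable[mF] (fun S : QuadConfig D => {Q : F | (Q : Quad D) ∈ S}) := by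
    refine measurable_set_iff.2 fun Q => measurable_to_prop ?_
    rw [preimage_singleton_true]
    exact MeasurableSpace.measurableSet_generateFrom ⟨Q, Q.2, rfl⟩
  exact hmeas (Set.toFinite T).measurableSet

/-- **(5.2) at a continuity quad from the mesh-DEPENDENT form of the gluing conclusion** — the form
the proof of Prop. 4.1 actually delivers before its last paragraph: for every `ε > 0` a finite set
`F` of (continuity) quads inside `U` such that FREQUENTLY along the sequence (for a sub-subsequence
of meshes) some `W ∈ σ(⊞_Q : Q ∈ F)`, possibly depending on the mesh, has `μs_k(W ∆ ⊞_{Q₀}) ≤ ε`.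
Then `⊞_{Q₀}` is `μ`-a.e. equal to an `𝓕_U`-measurable set: "since `𝓕_T` is finite, there are
finitely many possibilities for the event `𝓦`, and one of those works for a sub-subsequence"
(`exists_frequently_of_frequently_exists` on the truth table), "since we work with a (subsequential)
scaling limit, the limit … exists along the original subsequence and is equal to `μ₀(𝓦 ∆ ⊞_{Q₀})`"
(Cor. 5.2 at continuity quads, `tendsto_measure_of_null_frontier_generateFrom`), so that limit is
`≤ ε` (`IsClosed.mem_of_frequently_of_tendsto`).
[cite: SchrammSmirnov2011, proof of Prop. 4.1 (last paragraph) and proof of Thm. 1.7 (5.2)] -/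
theorem exists_measurableSet_crossingField_ae_eq_of_frequently_gluing (hD : IsOpen D)
    (hne : D.Nonempty) {μ : FiniteMeasure (QuadConfig D)} {μs : ℕ → FiniteMeasure (QuadConfig D)}
    (hlim : Tendsto μs atTop (𝓝 μ)) {U : Set ℂ} {Q₀ : Quad D}
    (hQ₀ : (μ : Measure (QuadConfig D)) (frontier (QuadConfig.crossedEvent Q₀)) = 0)
    (h41 : ∀ ε : ℝ, 0 < ε → ∃ F : Set (Quad D), F.Finite ∧
      (∀ Q ∈ F, Q.carrier ⊆ U ∧
        (μ : Measure (QuadConfig D)) (frontier (QuadConfig.crossedEvent Q)) = 0) ∧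
      ∃ᶠ k in atTop, ∃ W : Set (QuadConfig D),
        MeasurableSet[MeasurableSpace.generateFrom ((fun Q => QuadConfig.crossedEvent Q) '' F)] W ∧
        (μs k : Measure (QuadConfig D)) (W ∆ QuadConfig.crossedEvent Q₀) ≤ ENNReal.ofReal ε) :
    ∃ t, MeasurableSet[crossingField U] t ∧
      QuadConfig.crossedEvent Q₀ =ᵐ[(μ : Measure (QuadConfig D))] t := by
  refine exists_measurableSet_ae_eq_of_forall_approx fun ε hε => ?_
  obtain ⟨F, hF, hFU, hfreq⟩ := h41 ε hε
  haveI : Finite F := hF.to_subtype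
  -- pigeonhole on the truth table
  have hfreq' : ∃ᶠ k in atTop, ∃ T : Set (Set F), (μs k : Measure (QuadConfig D))
      (((fun S : QuadConfig D => {Q : F | (Q : Quad D) ∈ S}) ⁻¹' T) ∆ QuadConfig.crossedEvent Q₀) ≤
        ENNReal.ofReal ε := by
    refine hfreq.mono fun k hk => ?_
    obtain ⟨W, hW, hk⟩ := hk
    obtain ⟨T, rfl⟩ := exists_eq_preimage_of_measurableSet_generateFrom_crossedEvent hW
    exact ⟨T, hk⟩
  obtain ⟨T, hT⟩ := exists_frequently_of_frequently_exists hfreq'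
  set W : Set (QuadConfig D) := (fun S : QuadConfig D => {Q : F | (Q : Quad D) ∈ S}) ⁻¹' T with hWdef
  have hW := measurableSet_preimage_generateFrom_crossedEvent hF T
  refine ⟨W, ?_, ?_⟩
  · refine (MeasurableSpace.generateFrom_mono ?_) W hW
    rintro _ ⟨Q, hQ, rfl⟩
    exact ⟨Q, (hFU Q hQ).1, rfl⟩
  · -- Cor. 5.2 in `σ(⊞_Q : Q ∈ F ∪ {Q₀})`, and the limit of a frequently-small sequence
    have hmeas : MeasurableSet[MeasurableSpace.generateFrom
        ((fun Q => QuadConfig.crossedEvent Q) '' insert Q₀ F)] (W ∆ QuadConfig.crossedEvent Q₀) := by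
      refine MeasurableSet.symmDiff ?_
        (MeasurableSpace.measurableSet_generateFrom ⟨Q₀, mem_insert _ _, rfl⟩)
      exact MeasurableSpace.generateFrom_mono (image_mono (subset_insert _ _)) W hW
    have h₀ : ∀ Q ∈ insert Q₀ F,
        (μ : Measure (QuadConfig D)) (frontier (QuadConfig.crossedEvent Q)) = 0 := by
      rintro Q (rfl | hQ)
      · exact hQ₀
      · exact (hFU Q hQ).2
    have ht := tendsto_measure_of_null_frontier_generateFrom hD hne hlim (hF.insert Q₀) h₀ hmeas
    have hle : (μ : Measure (QuadConfig D)) (W ∆ QuadConfig.crossedEvent Q₀) ≤ ENNReal.ofReal ε :=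
      isClosed_Iic.mem_of_frequently_of_tendsto hT ht
    rwa [symmDiff_comm] at hle

/-- **Theorem 1.7 from the mesh-dependent gluing at continuity quads** — the assembly with the
weakest gluing hypothesis of this file: for `D` open connected, `μ` the limit of `μ_{δₖ}`, `α` a
cut and `Q₀` a `μ`-continuity quad, for every `ε > 0` a finite set `F` of `μ`-continuity quads inside
`D ∖ α` such that frequently in `k` some `W ∈ σ(⊞_Q : Q ∈ F)` has `μ_{δₖ}(W ∆ ⊞_{Q₀}) ≤ ε` (this is
what the proof of Prop. 4.1 establishes along the chosen sequence, the event depending on the mesh).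
[cite: SchrammSmirnov2011, Thm. 1.7 (proof) and Prop. 4.1 (proof, last paragraph)] -/
theorem SchrammSmirnov2011_thm_1_7_of_frequently_gluing
    (h41 : ∀ (D : Set ℂ), IsOpen D → IsConnected D →
      ∀ (μ : FiniteMeasure (QuadConfig D)) (δs : ℕ → ℝ), (∀ k, 0 < δs k) →
        Tendsto δs atTop (𝓝 0) → Tendsto (fun k => squareCrossingLaw D (δs k)) atTop (𝓝 μ) →
      ∀ α : Set ℂ, IsFiniteLengthPathUnion α →
      ∀ Q₀ : Quad D,
        (μ : Measure (QuadConfig D)) (frontier (QuadConfig.crossedEvent Q₀)) = 0 →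
      ∀ ε : ℝ, 0 < ε → ∃ F : Set (Quad D), F.Finite ∧
        (∀ Q ∈ F, Q.carrier ⊆ D \ α ∧
          (μ : Measure (QuadConfig D)) (frontier (QuadConfig.crossedEvent Q)) = 0) ∧
        ∃ᶠ k in atTop, ∃ W : Set (QuadConfig D),
          MeasurableSet[MeasurableSpace.generateFrom
            ((fun Q => QuadConfig.crossedEvent Q) '' F)] W ∧
          (squareCrossingLaw D (δs k) : Measure (QuadConfig D))
            (W ∆ QuadConfig.crossedEvent Q₀) ≤ ENNReal.ofReal ε) :
    SchrammSmirnov2011_thm_1_7 := by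
  intro D hD hD' μ hμ α hα
  obtain ⟨δs, hpos, h0, hlim⟩ := hμ
  refine aeIncluded_iSup_crossingField_of_dense SchrammSmirnov2011_thm_1_4_holds hD hD'.nonempty
    _ α (Quad.dense_setOf_measure_frontier_crossedEvent_eq_zero hD (μ : Measure (QuadConfig D)))
    fun Q₀ hQ₀ => ?_
  exact exists_measurableSet_crossingField_ae_eq_of_frequently_gluing hD hD'.nonempty hlim hQ₀
    (h41 D hD hD' μ δs hpos h0 hlim α hα Q₀ hQ₀)

end Endgame


/-! ### Co-countably many members of the perturbation family are continuity quads -/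

namespace Quad

section CoCountable

variable (H : ℂ ≃ₜ ℂ) {τ : ℝ} (hτ₀ : 0 ≤ τ) (hτ : τ ≤ 1 / 2)
  (hmem : ∀ a b : ℝ, |a - 1| ≤ τ → |b - 1| ≤ τ → ∀ p : I × I, H (rectMap a b p) ∈ D)

/-- **Null boundary at every continuity parameter.**  Along the family `Q_s = shrinkFamily H … s`,
if `s ↦ μ(⊞_{Q_s})` (real-valued) is continuous at an interior parameter `s₀ ∈ (0, τ)`, then
`μ(∂⊞_{Q_{s₀}}) = 0` (the sandwich `∂⊞_{Q_{s₀}} ⊆ ⊞_{Q_t} ∖ ⊞_{Q_s}`, `s < s₀ < t`).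
[cite: SchrammSmirnov2011, Lemma 5.1 (proof)] -/
theorem measure_frontier_crossedEvent_shrinkFamily_eq_zero_of_continuousAt
    (μ : Measure (QuadConfig D)) [IsFiniteMeasure μ] {s₀ : ℝ} (hs₀ : s₀ ∈ Ioo 0 τ)
    (hcont : ContinuousAt (fun s => (μ (QuadConfig.crossedEvent (shrinkFamily H hτ₀ hτ hmem s))).toReal) s₀) :
    μ (frontier (QuadConfig.crossedEvent (shrinkFamily H hτ₀ hτ hmem s₀))) = 0 := by
  set fam : ℝ → Quad D := shrinkFamily H hτ₀ hτ hmem with hfam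
  set g : ℝ → ℝ := fun s => (μ (QuadConfig.crossedEvent (fam s))).toReal with hg
  have hcl : ∀ {s : ℝ}, 0 ≤ s → s ≤ τ → clampTo τ s = s := fun h0 h1 => clampTo_of_mem h0 h1
  refine ((ENNReal.toReal_eq_zero_iff _).1
    (le_antisymm (le_of_forall_pos_le_add fun δ' hδ' => ?_) ENNReal.toReal_nonneg)).resolve_right
    (measure_ne_top _ _)
  rw [zero_add]
  obtain ⟨ρ, hρ, hgρ⟩ := Metric.continuousAt_iff.1 hcont (δ' / 2) (half_pos hδ')
  set ρ' : ℝ := min ρ (min s₀ (τ - s₀)) / 2 with hρ'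
  have hρ'₀ : 0 < ρ' := by
    have : 0 < min ρ (min s₀ (τ - s₀)) := lt_min hρ (lt_min hs₀.1 (by linarith [hs₀.2]))
    rw [hρ']; linarith
  have hρ'ρ : ρ' < ρ := by
    have := min_le_left ρ (min s₀ (τ - s₀)); rw [hρ']; linarith
  have hρ's : ρ' < s₀ := by
    have := (min_le_right ρ _).trans (min_le_left s₀ (τ - s₀)); rw [hρ']; linarith
  have hρ'τ : ρ' < τ - s₀ := by
    have := (min_le_right ρ _).trans (min_le_right s₀ (τ - s₀)); rw [hρ']; linarith
  set s : ℝ := s₀ - ρ' with hs_def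
  set t : ℝ := s₀ + ρ' with ht_def
  set m : ℝ := (s + s₀) / 2 with hm_def
  have h0s : 0 < s := by rw [hs_def]; linarith
  have hsm : s < m := by rw [hm_def]; linarith
  have hms₀ : m < s₀ := by rw [hm_def]; linarith
  have hs₀t : s₀ < t := by rw [ht_def]; linarith
  have htτ : t < τ := by rw [ht_def]; linarith
  have h1 : StrictlyDominated (fam t) (fam s₀) :=
    strictlyDominated_shrinkFamily H hτ₀ hτ _
      (by rw [hcl hs₀.1.le hs₀.2.le, hcl (by linarith) htτ.le]; exact hs₀t)
  have h2 : StrictlyDominated (fam s₀) (fam m) :=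
    strictlyDominated_shrinkFamily H hτ₀ hτ _
      (by rw [hcl hs₀.1.le hs₀.2.le, hcl (by linarith) (by linarith)]; exact hms₀)
  have h3 : StrictlyDominated (fam m) (fam s) :=
    strictlyDominated_shrinkFamily H hτ₀ hτ _
      (by rw [hcl h0s.le (by linarith), hcl (by linarith) (by linarith)]; exact hsm)
  have hle := QuadConfig.measure_frontier_crossedEvent_le μ h1 h2 h3
  have hst : μ (QuadConfig.crossedEvent (fam s)) ≤ μ (QuadConfig.crossedEvent (fam t)) :=
    measure_mono (monotone_crossedEvent_shrinkFamily H hτ₀ hτ _ (by linarith : s ≤ t))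
  have hgs : dist (g s) (g s₀) < δ' / 2 :=
    hgρ (by rw [dist_eq_norm, hs_def]; simp [abs_of_pos hρ'₀, hρ'ρ])
  have hgt : dist (g t) (g s₀) < δ' / 2 :=
    hgρ (by rw [dist_eq_norm, ht_def]; simp [abs_of_pos hρ'₀, hρ'ρ])
  rw [Real.dist_eq, abs_lt] at hgs hgt
  calc (μ (frontier (QuadConfig.crossedEvent (fam s₀)))).toReal
      ≤ (μ (QuadConfig.crossedEvent (fam t)) - μ (QuadConfig.crossedEvent (fam s))).toReal :=
        ENNReal.toReal_mono (ENNReal.sub_ne_top (measure_ne_top _ _)) hle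
    _ = g t - g s := by rw [hg]; exact ENNReal.toReal_sub_of_le hst (measure_ne_top _ _)
    _ ≤ δ' := by linarith [hgs.1, hgt.2]

/-- **All but countably many members of the family are `μ`-continuity quads**: the parameters
`s ∈ (0, τ)` with `μ(∂⊞_{Q_s}) ≠ 0` form a countable set (they are discontinuity points of the
monotone function `s ↦ μ(⊞_{Q_s})`).  Useful to impose, simultaneously with the continuity of
`⊞_{Q_s}`, countably many further generic conditions on the parameter.
[cite: SchrammSmirnov2011, Lemma 5.1 (proof) and proof of Thm. 1.7] -/
theorem countable_setOf_measure_frontier_crossedEvent_shrinkFamily_ne_zero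
    (μ : Measure (QuadConfig D)) [IsFiniteMeasure μ] :
    {s : ℝ | s ∈ Ioo 0 τ ∧
      μ (frontier (QuadConfig.crossedEvent (shrinkFamily H hτ₀ hτ hmem s))) ≠ 0}.Countable := by
  set g : ℝ → ℝ := fun s => (μ (QuadConfig.crossedEvent (shrinkFamily H hτ₀ hτ hmem s))).toReal
    with hg
  have hgmono : Monotone g := fun s t hst =>
    ENNReal.toReal_mono (measure_ne_top _ _)
      (measure_mono (monotone_crossedEvent_shrinkFamily H hτ₀ hτ hmem hst))
  refine hgmono.countable_not_continuousAt.mono ?_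
  rintro s ⟨hs, hne⟩ hcont
  exact hne (measure_frontier_crossedEvent_shrinkFamily_eq_zero_of_continuousAt H hτ₀ hτ hmem μ hs
    hcont)

/-- Hence, for every countable set `C` of excluded parameters, some parameter `s ∈ (0, τ)` off `C`
gives a `μ`-continuity quad `Q_s` (the good parameters are co-countable in an interval).
[cite: SchrammSmirnov2011, Lemma 5.1 (proof)] -/
theorem exists_mem_Ioo_notMem_measure_frontier_eq_zero (hτpos : 0 < τ)
    (μ : Measure (QuadConfig D)) [IsFiniteMeasure μ] {C : Set ℝ} (hC : C.Countable) :
    ∃ s ∈ Ioo 0 τ, s ∉ C ∧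
      μ (frontier (QuadConfig.crossedEvent (shrinkFamily H hτ₀ hτ hmem s))) = 0 := by
  have hbad := (countable_setOf_measure_frontier_crossedEvent_shrinkFamily_ne_zero H hτ₀ hτ hmem μ).union hC
  obtain ⟨s, hs, hsc⟩ : (Ioo 0 τ ∩ ({s : ℝ | s ∈ Ioo 0 τ ∧
      μ (frontier (QuadConfig.crossedEvent (shrinkFamily H hτ₀ hτ hmem s))) ≠ 0} ∪ C)ᶜ).Nonempty :=
    (hbad.dense_compl ℝ).inter_open_nonempty _ isOpen_Ioo (nonempty_Ioo.2 hτpos)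
  simp only [mem_compl_iff, mem_union, mem_setOf_eq, not_or, not_and, not_not] at hsc
  exact ⟨s, hs, hsc.2, hsc.1 hs⟩

end CoCountable

end Quad

end QuadCrossing

end Literature.Probability.Percolation

end
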